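import Summits.ResolutionOfSingularities.ResolutionOfSingularities.Theorems.MarkedTransferCampaignW13Bypass
import Literature.AlgebraicGeometry.Hironaka2017.NormThetaToolkit
import Literature.AlgebraicGeometry.Hironaka2017.Proofs.S13GLUEDDiagram.Def13p2Carrier
import Mathlib.Algebra.CharP.Lemmas
import HarnessLib

/-!
# [OURS · L1 W1.3] Architecture bypass — membership criteria for the three `Cot`'s, what the bypass drops,
# the dead literal lever, and the ring-level bridge `Diff^{(j)}(J) ⊆ ℘(Ě,1)` for the R-flat reading (seat res-L1-s13-pv-1)

LADDER-RESOLUTION rung L (rescue), cell `res-hironaka` (run/shared/lean/pub/res-hironaka/), RESCUE-SEED slot W1.3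
(«ARCHITECTURE BYPASS: drop `℘nega`»), campaign s13. Objects: the typed vocabulary of
`MarkedTransferCampaignW13Bypass.lean` (res-L1-type-o2; v3 p468546: `Campaign.bypassTSharp` / `bypassTFlat` / `bypassCot` = literal reading
R-hom, `Campaign.bypassTFlatRFlat` / `bypassCotRFlat` = degree-forgetting reading R-flat, `Campaign.pAlgPiece K J b j` = the
ring-level `℘(Ě,j)` of `Ě = (J,b)` bound to row 003's typed ALGEBRAIC characteristic algebra, `Campaign.BypassInvariant`
= the claim schema) over row 015's carriers `S13GLUEDDiagram.{TSharp, TFlat, Cot, rhoPowSpan, Eq104}`, row 073's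
`S11CoordFree.{BlSub, inDegree}`, row 076's `S12GLUED.{forgetDeg, fnorm}`. STATE OF THE SLOT when this file was written
(2026-08-26T21:30Z): kill test K1.3 DEAD for the literal lever R-hom (res-L1-k13, p466729 + j259562, REPRO MATCH j259840);
director's RULING 2026-08-26T20:36:49Z (2): the R-flat reading is NON-PROPAGATING on examples B/C/D and is THE s13
campaign reading, rung 1 = «`y(e)^q ∈ ℘(Ě,1)` for every LL-chain at every level» + the second disjoint check.
Helper filed `--supports stmt-ResolutionOfSingularities-15522` (host of the G1 OURS files, plan/SIZED-ASK-L.md §S-s13);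
PROOFS ONLY over existing decls — no new objects.

HONEST FRAMING. Nothing here is a statement of H. Hironaka's manuscript *Resolution of singularities in positive
characteristics* (2017-03-23, [Hironaka2017], lit key `paper:url-3343fd9e678b`); its Def 13.2 (p.67 L16–L22),
diagram (104) (p.67 L4–L10), §13.1 lead-in (p.67 L15), Th 14.4 (110) (p.69), Eq. (129) «h(i) ∈ ℘nega(Ě)» (p.84 L37) and
the definition of `℘` (p.17 L1–L11) are CANDIDATES [claim: Hironaka2017, status: under-review] that enter ONLY as the
typed carriers named above and as explicit hypotheses. No verdict on GAP-LEDGER rows R01/R04/R08 is implied; these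
are kernel facts about OURS readings. RESCUE-SEED's caveat stands: an R-flat NON-PROPAGATING finding still leaves
L-G4 / Eq. (127) open (barrier of record `Literature.Barriers.ResolutionOfSingularities.KangarooShadeIncrease`,
`Hauser2003_kangarooShadeIncrease` — the tails are order data). AI computation is weaker than expert review; nothing
here is progress on resolution of singularities in positive characteristic.

CONTENTS (all `[folklore]`, sorry-free; `q = p^e`):
REUSED, not restated (imported): res-type-076's `NormThetaToolkit` (`S12GLUED.forgetDeg_C_mul_T`, `fnorm_mono`,
`fnorm_sup`, …) and `Proofs/S13GLUEDDiagram/Def13p2Carrier` (`S13GLUEDDiagram.mem_TFlat_iff`, `pow_mem_rhoPowSpan`,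
`mem_Cot_iff`, `TFlat_eq_top_of_degree_full`, `Cot_eq_top_of_degree_full`, `TFlat_subset_ideal`, `Cot_subset_radical`).
§1 degree-forgetting calculus — `fnorm_inDegree` (`∥M·T^d∥ = M`), `fnorm_le_of_le_inDegree`.
§2 membership criteria — `mem_bypassCot_iff`, `mem_bypassCotRFlat_iff` (`φ ∈ Cot_flat ⟺ φ^q ∈ ∥𝔏_0(∞)∥ ∧ φ^q ∈ P1`),
   `mem_bypassCotRFlat_iff_baseline` (k13's mechanism «Cot_flat = Cot_baseline ∩ {φ : φ^q ∈ ℘(Ě,1)}», the baseline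
   reading W2 `𝔗♭ := ∥𝔏_0(∞)∥` being `TFlat L0inf ⊤ ⊥` in the typed vocabulary).
§3 what the bypass drops — `TFlat_eq_bypassTFlat_sup` (`𝔗♭ = 𝔗♭_bypass + ∥℘nega∥`), `bypassInvariant_fnorm_iff`
   (invariance of `𝔗♭` ⟺ `∥℘nega∥ ⊆ 𝔗♭_bypass`: the precise failure locus at the `𝔗♭` level),
   `fnorm_eq_top_of_degree_full` (under the R01 collapse «`℘nega(Ě,−a) = 𝒪`», `∥℘nega∥ = 𝒪`; the printed `𝔗♭` and
   `Cot` are then everything — `S13GLUEDDiagram.TFlat_eq_top_of_degree_full` / `Cot_eq_top_of_degree_full`, imported),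
   `bypassInvariant_fnorm_iff_of_degree_full`,
   `not_bypassInvariant_fnorm_of_degree_full` (then printed-vs-bypass invariance of `𝔗♭` FAILS as soon as
   `𝔗♭_bypass ⊆ I ≠ 𝒪`, e.g. `I = I(Sing)` via the §13.1 clause `𝔏_0(∞) ⊂ I(Sing)Bl(Z)`, `bypassTFlat_le_of_U67_2`).
§4 the dead literal lever (R-hom), for the record — `bypassTFlat_le_of_le_inDegree`, `inf_le_inDegree_of_Eq104`
   ((104)'s closing containment puts the bypass module in degree `q` with coefficients in `℘(Ě,q)`),
   `not_mem_bypassCot_of_pow_not_mem` (then `φ^q ∉ ℘(Ě,q) ⇒ φ ∉ Cot_bypass`: K1.3's death mechanism, kernel form).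
§5 the R-flat bridge at ring level — `mem_pAlgebraicRing_of_mem_diffSubalgebra`, `mem_pAlgPiece_iff`,
   `diffIdeal_le_pAlgPiece` (`Diff^{(j)}(J) ⊆ ℘(Ě, b−j)`, `j < b`, for the BOUND algebraic `℘` — by construction of
   row 003's carrier, no theorem of the manuscript used), `le_pAlgPiece_self` (`J ⊆ ℘(Ě,b)`), `diffIdeal_le_pAlgPiece_one`
   (`Diff^{(j)}(J) ⊆ ℘(Ě,1)` for `j < b`), `mul_mem_pAlgPiece`, and the rung-1 sufficient condition
   `pow_mem_pAlgPiece_one_of_sub_mem_diffIdeal` / `mem_bypassCotRFlatAlg_of_sub_mem_diffIdeal` («if the total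
   knock-out `g − y(e)^q` lies in `Diff^{(j)}(J)·𝒪` for some `j < q`, the tail survives the R-flat bypass»).
-/

noncomputable section

set_option linter.dupNamespace false -- mandated namespace of this single-conjunct summit

namespace Summit.ResolutionOfSingularities.ResolutionOfSingularities.Theorems.Campaign.W13

open LaurentPolynomial
open Literature.AlgebraicGeometry.Resolution
open Literature.AlgebraicGeometry.Hironaka2017
open Literature.AlgebraicGeometry.Hironaka2017.S11CoordFree (BlSub inDegree)
open Literature.AlgebraicGeometry.Hironaka2017.S12GLUED (forgetDeg fnorm forgetDeg_C_mul_T fnorm_mono fnorm_sup)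
open Literature.AlgebraicGeometry.Hironaka2017.S13GLUEDDiagram (TSharp TFlat Cot rhoPowSpan Eq104 U67_2 mem_Cot_iff
  pow_mem_rhoPowSpan TFlat_subset_ideal)

universe u v

/-! ## §1 Degree-forgetting calculus (`∥·∥` of row 076 on homogeneous elements and on `inDegree`) -/

section ForgetRho

variable {O : Type v} [CommRing O] {p : ℕ} [Fact p.Prime] [CharP O p] {ℓ : ℕ}

/-- `∥M·T^d∥ = M`: a submodule placed in one degree and then degree-forgotten is itself. [folklore] -/
theorem fnorm_inDegree (d : ℤ) (M : Submodule (iterateFrobenius O p ℓ).range O) :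
    fnorm (iterateFrobenius O p ℓ).range (inDegree d M) = M := by
  apply le_antisymm
  · rw [fnorm, inDegree, Submodule.map_span, Submodule.span_le]
    rintro _ ⟨_, ⟨a, ha, rfl⟩, rfl⟩
    simpa [forgetDeg_C_mul_T] using ha
  · intro a ha
    rw [fnorm, inDegree, Submodule.map_span]
    refine Submodule.subset_span ⟨C a * T d, ⟨a, ha, rfl⟩, ?_⟩
    simp [forgetDeg_C_mul_T]

/-- `X ⊆ M·T^d ⇒ ∥X∥ ⊆ M`. [folklore] -/
theorem fnorm_le_of_le_inDegree {X : BlSub O p ℓ} {d : ℤ} {M : Submodule (iterateFrobenius O p ℓ).range O}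
    (h : X ≤ inDegree d M) : fnorm (iterateFrobenius O p ℓ).range X ≤ M := by
  simpa [fnorm_inDegree] using fnorm_mono (iterateFrobenius O p ℓ).range h

end ForgetRho

/-! ## §2 Membership criteria for `Cot`, `bypassCot`, `bypassCotRFlat` -/

section Criteria

variable {O : Type v} [CommRing O] {p : ℕ} [Fact p.Prime] [CharP O p] {ℓ : ℕ}

/-- Membership in the literal bypass `Cot` (reading R-hom): `φ ∈ Cot_bypass ⟺ φ^q ∈ 𝔗♭_bypass`. [folklore] -/
theorem mem_bypassCot_iff (e : ℕ) (L0inf pposi : BlSub O p ℓ) (φ : O) :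
    φ ∈ Campaign.bypassCot e L0inf pposi ↔ φ ^ p ^ e ∈ Campaign.bypassTFlat L0inf pposi :=
  mem_Cot_iff e L0inf pposi ⊥ φ

/-- Membership in the R-flat bypass `Cot` (v2 `Campaign.bypassCotRFlat`): `φ ∈ Cot_flat ⟺ φ^q ∈ ∥𝔏_0(∞)∥ ∧ φ^q ∈ P1`.
[folklore] -/
theorem mem_bypassCotRFlat_iff (e : ℕ) (L0inf : BlSub O p ℓ) (P1 : Ideal O) (φ : O) :
    φ ∈ Campaign.bypassCotRFlat e L0inf P1 ↔
      φ ^ p ^ e ∈ fnorm (iterateFrobenius O p ℓ).range L0inf ∧ φ ^ p ^ e ∈ P1 := by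
  simp only [Campaign.bypassCotRFlat, Campaign.bypassTFlatRFlat, AddSubgroup.mem_comap,
    RingHom.toAddMonoidHom_eq_coe, AddMonoidHom.coe_coe, iterateFrobenius_def, AddSubgroup.mem_inf,
    Submodule.mem_toAddSubgroup, Submodule.mem_inf, Submodule.restrictScalars_mem]
  exact ⟨fun h => h.1, fun h => ⟨h, pow_mem_rhoPowSpan e φ⟩⟩

/-- The baseline reading W2 («`𝔗♭ := ∥𝔏_0(∞)∥`», the reading under which §§14–16 are non-degenerate; res-L1-k13's
BASELINE) is `TFlat L0inf ⊤ ⊥` in the typed vocabulary. [folklore] -/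
theorem TFlat_top_bot (L0inf : BlSub O p ℓ) :
    TFlat L0inf ⊤ ⊥ = fnorm (iterateFrobenius O p ℓ).range L0inf := by
  simp [TFlat, TSharp]

/-- k13's mechanism line, kernel form: `Cot_flat = Cot_baseline ∩ {φ : φ^q ∈ P1}` — membership in the R-flat `Cot` is
membership in the baseline `Cot` (reading W2) plus the one extra condition `φ^q ∈ P1` (`P1` standing for `℘(Ě,1)`).
[folklore] -/
theorem mem_bypassCotRFlat_iff_baseline (e : ℕ) (L0inf : BlSub O p ℓ) (P1 : Ideal O) (φ : O) :
    φ ∈ Campaign.bypassCotRFlat e L0inf P1 ↔ φ ∈ Cot e L0inf ⊤ ⊥ ∧ φ ^ p ^ e ∈ P1 := by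
  rw [mem_bypassCotRFlat_iff, mem_Cot_iff, TFlat_top_bot]

end Criteria

/-! ## §3 What the bypass drops: `𝔗♭ = 𝔗♭_bypass + ∥℘nega∥`, and the R01 collapse -/

section Drops

variable {O : Type v} [CommRing O] {p : ℕ} [Fact p.Prime] [CharP O p] {ℓ : ℕ}

/-- Def 13.2's flat module splits as the bypass flat module plus the degree-forgotten `℘nega` parameter:
`𝔗♭ = ∥(𝔏_0(∞) ∩ ℘posi) + ℘nega∥ = 𝔗♭_bypass + ∥℘nega∥`. [folklore] -/
theorem TFlat_eq_bypassTFlat_sup (L0inf pposi pnega : BlSub O p ℓ) :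
    TFlat L0inf pposi pnega =
      Campaign.bypassTFlat L0inf pposi ⊔ fnorm (iterateFrobenius O p ℓ).range pnega := by
  simp [TFlat, TSharp, Campaign.bypassTFlat, fnorm_sup]

/-- `𝔗♭_bypass ⊆ 𝔗♭`. [folklore] -/
theorem bypassTFlat_le_TFlat (L0inf pposi pnega : BlSub O p ℓ) :
    Campaign.bypassTFlat L0inf pposi ≤ TFlat L0inf pposi pnega := by
  rw [TFlat_eq_bypassTFlat_sup]; exact le_sup_left

/-- PRECISE FAILURE LOCUS AT THE `𝔗♭` LEVEL. The schema `Campaign.BypassInvariant` instantiated with the reader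
`F = ∥·∥` (the first thing every consumer of `𝔗♯` does, Def 13.2 p.67 L19) holds iff `∥℘nega∥ ⊆ 𝔗♭_bypass`: the
bypass changes `𝔗♭` exactly by the part of `∥℘nega∥` not already in `∥𝔏_0(∞) ∩ ℘posi∥`. [folklore] -/
theorem bypassInvariant_fnorm_iff (L0inf pposi pnega : BlSub O p ℓ) :
    Campaign.BypassInvariant (fnorm (iterateFrobenius O p ℓ).range) L0inf pposi pnega ↔
      fnorm (iterateFrobenius O p ℓ).range pnega ≤ Campaign.bypassTFlat L0inf pposi := by
  rw [Campaign.BypassInvariant]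
  change TFlat L0inf pposi pnega = Campaign.bypassTFlat L0inf pposi ↔ _
  rw [TFlat_eq_bypassTFlat_sup, sup_eq_left]

/-- If the `℘nega` parameter contains a FULL degree (`c·T^a ∈ ℘nega` for every `c ∈ 𝒪` — the R01 collapse
«`℘nega(Ě,−a) = 𝒪_Z` for `a > 0`», GAP-LEDGER R01 DOES-NOT-FOLLOW-AS-PRINTED, reading R1), then `∥℘nega∥ = 𝒪`.
[folklore] -/
theorem fnorm_eq_top_of_degree_full {pnega : BlSub O p ℓ} {a : ℤ} (h : ∀ c : O, C c * T a ∈ pnega) :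
    fnorm (iterateFrobenius O p ℓ).range pnega = ⊤ := by
  refine eq_top_iff.mpr fun c _ => ?_
  exact ⟨C c * T a, h c, forgetDeg_C_mul_T _ _ c a⟩

/-- Under the collapse, printed-vs-bypass invariance of `𝔗♭` holds iff the bypass flat module is itself everything.
[folklore] -/
theorem bypassInvariant_fnorm_iff_of_degree_full (L0inf pposi : BlSub O p ℓ) {pnega : BlSub O p ℓ} {a : ℤ}
    (h : ∀ c : O, C c * T a ∈ pnega) :
    Campaign.BypassInvariant (fnorm (iterateFrobenius O p ℓ).range) L0inf pposi pnega ↔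
      Campaign.bypassTFlat L0inf pposi = ⊤ := by
  rw [bypassInvariant_fnorm_iff, fnorm_eq_top_of_degree_full h, top_le_iff]

/-- Under the collapse, printed-vs-bypass invariance of `𝔗♭` FAILS as soon as the bypass flat module sits inside a
proper ideal `I` (e.g. `I = I(Sing(Ě))`, see `bypassTFlat_le_of_U67_2`). This is why the campaign compares the bypass
with the manuscript's intended local data (baseline W2), not with the printed (collapsed) `𝔗♯`. [folklore] -/
theorem not_bypassInvariant_fnorm_of_degree_full (L0inf pposi : BlSub O p ℓ) {pnega : BlSub O p ℓ} {a : ℤ}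
    (h : ∀ c : O, C c * T a ∈ pnega) {I : Ideal O}
    (hI : Campaign.bypassTFlat L0inf pposi ≤ I.restrictScalars _) (hI' : I ≠ ⊤) :
    ¬ Campaign.BypassInvariant (fnorm (iterateFrobenius O p ℓ).range) L0inf pposi pnega := by
  rw [bypassInvariant_fnorm_iff_of_degree_full L0inf pposi h]
  intro htop
  apply hI'
  rw [eq_top_iff]
  intro c _
  have hc : c ∈ Campaign.bypassTFlat L0inf pposi := by rw [htop]; exact Submodule.mem_top
  exact hI hc

/-- The §13.1 clause «`𝔏_0(∞) = τ(𝔏_0(∞)) ⊂ I(Sing)Bl(Z)`» (row 015 `U67_2`, p.67 L15), taken as a hypothesis, puts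
the bypass flat module inside `I(Sing)`. [folklore] -/
theorem bypassTFlat_le_of_U67_2 {tau0 : BlSub O p ℓ → BlSub O p ℓ} {L0inf : BlSub O p ℓ} {ISing : Ideal O}
    (hU : U67_2 tau0 L0inf ISing) (pposi : BlSub O p ℓ) :
    Campaign.bypassTFlat L0inf pposi ≤ ISing.restrictScalars _ :=
  fun _ hb => TFlat_subset_ideal L0inf pposi ⊥ ISing (inf_le_left.trans hU.2) bot_le hb

end Drops

/-! ## §4 The dead literal lever (reading R-hom), for the record -/

section Literal

variable {O : Type v} [CommRing O] {p : ℕ} [Fact p.Prime] [CharP O p] {ℓ : ℕ}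

/-- If the positive part `𝔏_0(∞) ∩ ℘posi` of the chain module is concentrated in one degree `d` with coefficients in
`M` (for `d = q`, `M = ℘(Ě,q)`: the content of diagram (104)'s closing containment p.67 L9–L10, equivalently of
Th 14.4 (110) p.69 together with `℘posi = ⊕_{b>0} ℘(Ě,b)·T^b`), then the literal bypass flat module lies in `M`.
[folklore] -/
theorem bypassTFlat_le_of_le_inDegree {L0inf pposi : BlSub O p ℓ} {d : ℤ}
    {M : Submodule (iterateFrobenius O p ℓ).range O} (h : L0inf ⊓ pposi ≤ inDegree d M) :
    Campaign.bypassTFlat L0inf pposi ≤ M := by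
  rw [Campaign.bypassTFlat, TFlat, TSharp, sup_bot_eq]
  exact fnorm_le_of_le_inDegree h

/-- Row 015's `Eq104` (the closing containment «`𝔏_0(∞) ⊂ ℘posi(Ě,p^e) ∩ ρ^e(Bl(Z,1))`» of diagram (104), typed for a
family `L` with `𝔏_0(∞) = L e ⊤` and the parameter `pposiPe`), instantiated with `pposiPe := ℘(Ě,q)·T^q`, gives the
concentration hypothesis of `bypassTFlat_le_of_le_inDegree` for every `℘posi` parameter. [folklore] -/
theorem inf_le_inDegree_of_Eq104 {e : ℕ} {L : ℕ → ℕ∞ → BlSub O p ℓ}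
    {M : Submodule (iterateFrobenius O p ℓ).range O} (h : Eq104 e L (inDegree ((p : ℤ) ^ e) M))
    (pposi : BlSub O p ℓ) : L e ⊤ ⊓ pposi ≤ inDegree ((p : ℤ) ^ e) M :=
  inf_le_left.trans (h.trans inf_le_left)

/-- K1.3's death mechanism, kernel form (res-L1-k13, KILL-TEST-K1.3.md §3 «Mechanism (R-hom)»): with the positive part
of `𝔏_0(∞)` in degree `d` with coefficients in `M = ℘(Ě,q)`, any `φ` with `φ^q ∉ ℘(Ě,q)` — every LL-tail at a point
with `q > 1`, by the NEG certificates — is NOT in the literal bypass `Cot`. The dead lever; no prover re-walks it.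
[folklore] -/
theorem not_mem_bypassCot_of_pow_not_mem {e : ℕ} {L0inf pposi : BlSub O p ℓ} {d : ℤ}
    {M : Submodule (iterateFrobenius O p ℓ).range O} (h : L0inf ⊓ pposi ≤ inDegree d M) {φ : O}
    (hφ : φ ^ p ^ e ∉ M) : φ ∉ Campaign.bypassCot e L0inf pposi := by
  rw [mem_bypassCot_iff]
  exact fun hmem => hφ (bypassTFlat_le_of_le_inDegree h hmem)

end Literal

/-! ## §5 The R-flat bridge at ring level: `Diff^{(j)}(J) ⊆ ℘(Ě,1)` for the bound algebraic `℘` -/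

section Bridge

open Polynomial
open Literature.AlgebraicGeometry.Hironaka2017.S04CharAlgebra

variable (K : Type u) [CommRing K] {O : Type u} [CommRing O] [Algebra K O]

/-- The generators' algebra lies in its integral closure: every element of row 003's `diffSubalgebra K O J b`
(«`O_Z[⊕_{0≤j<b} (Diff^{(j)}_Z) J]`», Th 4.4 p.18 L5–12) lies in `pAlgebraicRing K O J b` (U17_2 p.17 L8–L11, the
ALGEBRAIC `℘`). A property of the typed construction, not a theorem of the manuscript. [folklore] -/
theorem mem_pAlgebraicRing_of_mem_diffSubalgebra (J : Ideal O) (b : ℕ) {x : O[X]}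
    (hx : x ∈ diffSubalgebra K O J b) : x ∈ pAlgebraicRing K O J b := by
  rw [pAlgebraicRing, Subalgebra.mem_restrictScalars, mem_integralClosure_iff]
  exact isIntegral_algebraMap (R := ↥(diffSubalgebra K O J b)) (x := ⟨x, hx⟩)

/-- Unfolding of the v3 binding: `c ∈ pAlgPiece K J b j ⟺ c·X^j ∈ pAlgebraicRing K O J b`. [folklore] -/
theorem mem_pAlgPiece_iff (J : Ideal O) (b j : ℕ) (c : O) :
    c ∈ Campaign.pAlgPiece K J b j ↔ monomial j c ∈ pAlgebraicRing K O J b :=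
  Iff.rfl

/-- `Diff^{(j)}(J) ⊆ ℘(Ě, b−j)` for `j < b` (`Ě = (J,b)`, bound algebraic `℘`): the degree-`(b−j)` generators. Tree
`Resolution.diffIdeal K j J` = values of the `K`-linear differential operators of order `≤ j` on `J`. [folklore] -/
theorem diffIdeal_le_pAlgPiece (J : Ideal O) {b j : ℕ} (hj : j < b) :
    diffIdeal K j J ≤ Campaign.pAlgPiece K J b (b - j) := by
  intro c hc
  rw [mem_pAlgPiece_iff]
  apply mem_pAlgebraicRing_of_mem_diffSubalgebra
  exact Algebra.subset_adjoin ⟨j, hj, c, hc, rfl⟩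

/-- `J ⊆ ℘(Ě, b)` for `Ě = (J, b)`, `b > 0` (bound algebraic `℘`). [folklore] -/
theorem le_pAlgPiece_self (J : Ideal O) {b : ℕ} (hb : 0 < b) : J ≤ Campaign.pAlgPiece K J b b := by
  have h := diffIdeal_le_pAlgPiece K J hb
  rw [Nat.sub_zero] at h
  exact (le_diffIdeal K 0 J).trans h

/-- `Diff^{(j)}(J) ⊆ ℘(Ě,1)` for every `j < b` (through `Diff^{(j)} ⊆ Diff^{(b−1)}`): the ideal every R-flat POS
certificate lands in. In particular `J ⊆ ℘(Ě,1)` and `x·∂g ∈ ℘(Ě,1)` for `g ∈ J`, `∂` of order `< b`. [folklore] -/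
theorem diffIdeal_le_pAlgPiece_one (J : Ideal O) {b j : ℕ} (hb : 0 < b) (hj : j < b) :
    diffIdeal K j J ≤ Campaign.pAlgPiece K J b 1 := by
  have h := diffIdeal_le_pAlgPiece K J (Nat.sub_one_lt_of_le hb le_rfl)
  rw [Nat.sub_sub_self hb] at h
  exact (diffIdeal_mono_left K (by omega) J).trans h

/-- The bound pieces multiply: `℘(Ě,i)·℘(Ě,j) ⊆ ℘(Ě,i+j)` (the carrier is a subalgebra of `O[X]`). [folklore] -/
theorem mul_mem_pAlgPiece (J : Ideal O) (b : ℕ) {i j : ℕ} {c d : O}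
    (hc : c ∈ Campaign.pAlgPiece K J b i) (hd : d ∈ Campaign.pAlgPiece K J b j) :
    c * d ∈ Campaign.pAlgPiece K J b (i + j) := by
  rw [mem_pAlgPiece_iff] at hc hd ⊢
  have := Subalgebra.mul_mem _ hc hd
  rwa [monomial_mul_monomial] at this

/-- RUNG-1 SUFFICIENT CONDITION (reading R-flat, ring level, bound `℘`): if the total knock-out `g − τ^{n}` of a head
`g ∈ J` with tail power `τ^n` lies in `Diff^{(j)}(J)` for some `j < b`, then `τ^n ∈ ℘(Ě,1)`. On the recorded examples
this is the POS certificate «`H = x·∂g`» (res-L1-k13). [folklore] -/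
theorem pow_mem_pAlgPiece_one_of_sub_mem_diffIdeal (J : Ideal O) {b j : ℕ} (hb : 0 < b) (hj : j < b)
    {g τ : O} {n : ℕ} (hg : g ∈ J) (hknock : g - τ ^ n ∈ diffIdeal K j J) :
    τ ^ n ∈ Campaign.pAlgPiece K J b 1 := by
  have h1 : g ∈ Campaign.pAlgPiece K J b 1 := diffIdeal_le_pAlgPiece_one K J hb hj (le_diffIdeal K j J hg)
  have h2 : g - τ ^ n ∈ Campaign.pAlgPiece K J b 1 := diffIdeal_le_pAlgPiece_one K J hb hj hknock
  simpa using Ideal.sub_mem _ h1 h2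

end Bridge

section BridgeCot

open Literature.AlgebraicGeometry.Hironaka2017.S04CharAlgebra

variable (K : Type u) [CommRing K] {O : Type u} [CommRing O] [Algebra K O] {p : ℕ} [Fact p.Prime] [CharP O p]
  {ℓ : ℕ}

/-- RUNG-1 SUFFICIENT CONDITION, `Cot` form (v3 `Campaign.bypassCotRFlatAlg`, `P1 := ℘(Ě,1)` bound): a tail `τ`
whose `q`-th power lies in the baseline flat module `∥𝔏_0(∞)∥` (the manuscript's (107)/(108) at the point — a
HYPOTHESIS on the parameter `L0inf`) and whose knock-out `g − τ^q` lies in some `Diff^{(j)}(J)`, `j < b`, survives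
the R-flat bypass. [folklore] -/
theorem mem_bypassCotRFlatAlg_of_sub_mem_diffIdeal (J : Ideal O) {b j : ℕ} (hb : 0 < b) (hj : j < b) (e : ℕ)
    (L0inf : BlSub O p ℓ) {g τ : O} (hg : g ∈ J) (hknock : g - τ ^ p ^ e ∈ diffIdeal K j J)
    (h107 : τ ^ p ^ e ∈ fnorm (iterateFrobenius O p ℓ).range L0inf) :
    τ ∈ Campaign.bypassCotRFlatAlg K e J b L0inf := by
  rw [Campaign.bypassCotRFlatAlg, mem_bypassCotRFlat_iff]
  exact ⟨h107, pow_mem_pAlgPiece_one_of_sub_mem_diffIdeal K J hb hj hg hknock⟩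

end BridgeCot

end Summit.ResolutionOfSingularities.ResolutionOfSingularities.Theorems.Campaign.W13

end
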